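import Literature.Combinatorics.Designs.MannSubsquareObstruction
import Summits.Ventures.DiscreteObjects.Verify.DesignsKernel

/-!
# Five MOLS of order 12 from orthomorphisms of `Z₂ × Z₆` — the (+) control `N(12) ≥ 5` in the kernel
Framing: lottery ticket; floor = certified bounds/negative ranges.

Cell pub-namedobj (venture DiscreteObjects), target (M), family B3 ('11 MOLS(12) with structure; floor = the record `N(12) ≥ 5` and
its construction re-derived as (+) control', PLAN-M §2), designs gen 9.  Johnson–Dulmage–Mendelsohn (1961) found four pairwise
orthogonal orthomorphisms of the group `C₆ × C₂`, giving five mutually orthogonal Latin squares of order 12 (Keedwell–Dénes 2015,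
§7.1: `L_θ(x, y) = θ(x) + y`; `L_θ ⊥ L_ψ` iff `θ - ψ` is a bijection); `N(12) ≥ 5` is still the record.  The four orthomorphisms
below were re-found by a 0.2 s hub-local search (`pub-namedobj-designs-g9/code/mols12_search.py`, 16 512 normalised orthomorphisms of
`Z₂ × Z₆`) — the published maps are not reprinted in the held text, so these are A solution, not necessarily JDM's.  Kernel content:
* `isLatinSquare_addTable`, `isOrthogonalMate_addTable` — the orthomorphism criterion over any finite additive commutative group
  (`Literature…LatinSquares.IsLatinSquare` / `IsOrthogonalMate`);
* `theta k` (`k : Fin 5`; `theta 0 = id`) on `ZMod 2 × ZMod 6`, pairwise differences injective (`decide`), hence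
  **`five_MOLS_twelve`**: five Latin squares of order 12, pairwise orthogonal — `N(12) ≥ 5` as a kernel theorem on explicit objects;
* `fiveMols12_isMOLS` — the same five squares as `Fin 12` tables pass verify-ref's Bool checker `Verify.isMOLS` (`decide`).
Replication of print (JDM 1961); no novelty; zero farm compute.
-/

namespace Summit.Ventures.DiscreteObjects.MOLS

open Function Literature.Combinatorics.Designs.LatinSquares

/-! ### The orthomorphism criterion -/

section Criterion

variable {G : Type*} [AddCommGroup G] [Fintype G]

omit [Fintype G] in
/-- `L_θ(x,y) = θ x + y` is a Latin square when `θ` is injective. [Keedwell–Dénes 2015, §7.1] -/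
theorem isLatinSquare_addTable {θ : G → G} (hθ : Injective θ) : IsLatinSquare fun x y => θ x + y :=
  ⟨fun _ _ _ h => add_left_cancel h, fun _ _ _ h => hθ (add_right_cancel h)⟩

omit [Fintype G] in
/-- `L_θ ⊥ L_ψ` when `x ↦ θ x - ψ x` is injective. [Keedwell–Dénes 2015, §7.1] -/
theorem isOrthogonalMate_addTable {θ ψ : G → G} (h : Injective fun x => θ x - ψ x) :
    IsOrthogonalMate (fun x y => θ x + y) (fun x y => ψ x + y) := by
  rintro ⟨x, y⟩ ⟨x', y'⟩ hxy
  simp only [Prod.mk.injEq] at hxy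
  obtain ⟨h1, h2⟩ := hxy
  have hx : x = x' := h (by
    show θ x - ψ x = θ x' - ψ x'
    have e : θ x - ψ x = (θ x + y) - (ψ x + y) := by abel
    rw [e, h1, h2]; abel)
  subst hx
  exact Prod.ext rfl (add_left_cancel h1)

end Criterion

/-! ### The five squares of order 12 -/

/-- the group `Z₂ × Z₆` coded by `6a + b` -/
abbrev G12 := ZMod 2 × ZMod 6

/-- decode `0 … 11` as `(e / 6, e % 6)` -/
def dec12 (e : Fin 12) : G12 := ((e.val / 6 : ℕ), (e.val % 6 : ℕ))

/-- encode `(a, b)` as `6a + b` -/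
def enc12 (x : G12) : Fin 12 := ⟨(6 * x.1.val + x.2.val) % 12, Nat.mod_lt _ (by norm_num)⟩

/-- the four orthomorphisms (as tables on the codes) and the identity -/
def thetaTab : Fin 5 → Fin 12 → Fin 12
  | 0 => id
  | 1 => ![0, 2, 1, 6, 8, 7, 10, 9, 11, 4, 3, 5]
  | 2 => ![0, 3, 8, 10, 1, 9, 2, 6, 5, 7, 11, 4]
  | 3 => ![0, 4, 10, 9, 7, 1, 11, 5, 3, 2, 8, 6]
  | 4 => ![0, 8, 6, 4, 3, 10, 9, 11, 2, 5, 1, 7]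

/-- the five maps `θ_k : Z₂ × Z₆ → Z₂ × Z₆` -/
def theta (k : Fin 5) (x : G12) : G12 := dec12 (thetaTab k (enc12 x))

/-- the five squares `L_k(x, y) = θ_k x + y` -/
def sq (k : Fin 5) : G12 → G12 → G12 := fun x y => theta k x + y

/-- every `θ_k` is injective (kernel `decide`) -/
theorem theta_injective : ∀ k : Fin 5, Injective (theta k) := by
  unfold Injective theta; decide

/-- pairwise differences are injective: the `θ_k` are pairwise orthogonal orthomorphisms (kernel `decide`) -/
theorem theta_sub_injective : ∀ k k' : Fin 5, k ≠ k' → Injective fun x => theta k x - theta k' x := by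
  unfold Injective theta; decide

/-- **`N(12) ≥ 5` in the kernel:** the five squares `sq k` of order 12 are Latin and pairwise orthogonal. -/
theorem five_MOLS_twelve :
    (∀ k : Fin 5, IsLatinSquare (sq k)) ∧ ∀ k k' : Fin 5, k ≠ k' → IsOrthogonalMate (sq k) (sq k') :=
  ⟨fun k => isLatinSquare_addTable (theta_injective k), fun k k' h => isOrthogonalMate_addTable (theta_sub_injective k k' h)⟩

/-- the order is twelve -/
theorem card_G12 : Fintype.card G12 = 12 := by simp [G12, ZMod.card]

/-! ### The same squares through verify-ref's Bool checker -/

/-- the five squares as `12 × 12` tables of naturals (row `x`, column `y`, entry code of `θ_k x + y`) -/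
def fiveMols12 : List (List (List Nat)) :=
  (List.finRange 5).map fun k => (List.finRange 12).map fun x => (List.finRange 12).map fun y =>
    (enc12 (theta k (dec12 x) + dec12 y)).val

/-- the five tables pass `Verify.isMOLS` (Latin, pairwise orthogonal; kernel `decide`) -/
theorem fiveMols12_isMOLS : Summit.Ventures.DiscreteObjects.Verify.isMOLS fiveMols12 = true := by
  decide +kernel

end Summit.Ventures.DiscreteObjects.MOLS
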